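import Literature.NumberTheory.EllipticCurves.IwasawaAlgebraInvolution
import Literature.NumberTheory.EllipticCurves.KatoRankBoundProofs
import HarnessLib

/-!
# The height-one primes of `Λ = ℤ_p⟦T⟧` FIXED by the Iwasawa involution `ι : T ↦ (1+T)⁻¹ − 1`:
# the augmentation prime `(T)` and the prime `(p)`

Topic `NumberTheory/EllipticCurves` (next to `IwasawaAlgebraInvolution`, the named involution
`IwasawaAlgebra.invol p`). Proofs-only companion (theorems, no definition, no named fact, no instance):

* `constantCoeff_invol`: `ι` preserves the constant term (`ι T` has constant term `0`).
* `invol_mem_span_X_iff`, `comap_invol_span_X`, `comap_invol_primeT`: `ι` fixes the augmentation prime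
  `(T)` — as an ideal and as the point `IwasawaAlgebra.primeT p` of `Spec Λ`
  (`PrimeSpectrum.comap (invol p).toRingHom (primeT p) = primeT p`).
* `comap_invol_span_C`, `comap_invol_eq_self_of_asIdeal_eq_augIdealP`: `ι` fixes `(C c)` for every constant,
  in particular the prime `(p) = augIdealP p`.

These are the primes at which descent to `ℚ` reads orders of vanishing (`(T)`) and `μ`-invariants (`(p)`);
statements «at every `ι`-fixed height-one prime» (e.g. the K8 cell's
`…PlusKatoDivisibilityBranchOntoFixedPrimesOfNamedFactsContra`) specialise to them by these lemmas.

References: [Washington1997] §7.1, §13.2; [MazurTateTeitelbaum1986Invent] Ch. I §17; [GreenbergLNM1716] §1 p. 60.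
-/

noncomputable section

namespace Literature.NumberTheory.EllipticCurves.IwasawaAlgebra

open PowerSeries

variable (p : ℕ) [Fact p.Prime]

/-- `ι T = (1+T)⁻¹ − 1` has constant term `0`. [cite: Washington1997, §7.1] -/
theorem constantCoeff_invol_X : constantCoeff (invol p PowerSeries.X) = 0 := by
  rw [invol_X]
  exact constantCoeff_invSubOne p

/-- **`ι` preserves the constant term**: `(ι f)(0) = f(0)` (substitution of a series without constant term).
[cite: MazurTateTeitelbaum1986Invent, Ch. I §17] -/
theorem constantCoeff_invol (f : IwasawaAlgebra p) : constantCoeff (invol p f) = constantCoeff f := by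
  rw [invol_apply, ← coeff_zero_eq_constantCoeff_apply,
    coeff_subst' (HasSubst.of_constantCoeff_zero' (constantCoeff_invSubOne p)), finsum_eq_single _ 0]
  · simp
  · intro d hd
    rw [coeff_zero_eq_constantCoeff_apply, map_pow, constantCoeff_invSubOne, zero_pow hd, smul_zero]

/-- `f ∈ (T) ↔ f(0) = 0`. [cite: Washington1997, §7.1] -/
theorem mem_span_X_iff_constantCoeff (f : IwasawaAlgebra p) :
    f ∈ Ideal.span ({PowerSeries.X} : Set (IwasawaAlgebra p)) ↔ constantCoeff f = 0 := by
  rw [Ideal.mem_span_singleton]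
  exact PowerSeries.X_dvd_iff

/-- **`ι f ∈ (T) ↔ f ∈ (T)`.** [cite: Washington1997, §7.1 and §13.2] -/
theorem invol_mem_span_X_iff (f : IwasawaAlgebra p) :
    invol p f ∈ Ideal.span ({PowerSeries.X} : Set (IwasawaAlgebra p)) ↔
      f ∈ Ideal.span ({PowerSeries.X} : Set (IwasawaAlgebra p)) := by
  rw [mem_span_X_iff_constantCoeff, mem_span_X_iff_constantCoeff, constantCoeff_invol]

/-- **`ι⁻¹(T) = (T)`** as ideals: the augmentation ideal is fixed by the involution. [cite: Washington1997, §13.2] -/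
theorem comap_invol_span_X :
    (Ideal.span ({PowerSeries.X} : Set (IwasawaAlgebra p))).comap (invol p).toRingHom =
      Ideal.span ({PowerSeries.X} : Set (IwasawaAlgebra p)) := by
  ext f
  rw [Ideal.mem_comap]
  exact invol_mem_span_X_iff p f

/-- **The augmentation prime `(T)` is an `ι`-fixed point of `Spec Λ`**:
`PrimeSpectrum.comap ι (primeT p) = primeT p`. [cite: Washington1997, §13.2] -/
theorem comap_invol_primeT :
    PrimeSpectrum.comap (invol p).toRingHom (primeT p) = primeT p :=
  PrimeSpectrum.ext (by rw [PrimeSpectrum.comap_asIdeal, primeT_asIdeal, comap_invol_span_X])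

/-- `ι f ∈ (C c) ↔ f ∈ (C c)` for a constant `c` (`ι` is a `ℤ_p`-algebra automorphism with `ι ∘ ι = id`).
[cite: MazurTateTeitelbaum1986Invent, Ch. I §17] -/
theorem invol_mem_span_C_iff (c : ℤ_[p]) (f : IwasawaAlgebra p) :
    invol p f ∈ Ideal.span ({PowerSeries.C c} : Set (IwasawaAlgebra p)) ↔
      f ∈ Ideal.span ({PowerSeries.C c} : Set (IwasawaAlgebra p)) := by
  simp only [Ideal.mem_span_singleton]
  constructor
  · rintro ⟨g, hg⟩
    refine ⟨invol p g, ?_⟩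
    have h := congrArg (invol p) hg
    rwa [invol_invol, map_mul, invol_C] at h
  · rintro ⟨g, hg⟩
    exact ⟨invol p g, by rw [hg, map_mul, invol_C]⟩

/-- **`ι⁻¹(C c) = (C c)`** as ideals, for every constant `c ∈ ℤ_p`. [cite: MazurTateTeitelbaum1986Invent, Ch. I §17] -/
theorem comap_invol_span_C (c : ℤ_[p]) :
    (Ideal.span ({PowerSeries.C c} : Set (IwasawaAlgebra p))).comap (invol p).toRingHom =
      Ideal.span ({PowerSeries.C c} : Set (IwasawaAlgebra p)) := by
  ext f
  rw [Ideal.mem_comap]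
  exact invol_mem_span_C_iff p c f

/-- **The prime `(p) = augIdealP p` is an `ι`-fixed point of `Spec Λ`**: for every point `𝔭` with
`𝔭.asIdeal = augIdealP p`, `PrimeSpectrum.comap ι 𝔭 = 𝔭`. [cite: Washington1997, §13.2] -/
theorem comap_invol_eq_self_of_asIdeal_eq_augIdealP (𝔭 : PrimeSpectrum (IwasawaAlgebra p))
    (h𝔭 : 𝔭.asIdeal = augIdealP p) :
    PrimeSpectrum.comap (invol p).toRingHom 𝔭 = 𝔭 :=
  PrimeSpectrum.ext (by rw [PrimeSpectrum.comap_asIdeal, h𝔭, augIdealP, comap_invol_span_C])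

/-- The same for any principal prime generated by a constant: if `𝔭.asIdeal = (C c)` then `ι𝔭 = 𝔭`.
[cite: MazurTateTeitelbaum1986Invent, Ch. I §17] -/
theorem comap_invol_eq_self_of_asIdeal_eq_span_C (𝔭 : PrimeSpectrum (IwasawaAlgebra p)) (c : ℤ_[p])
    (h𝔭 : 𝔭.asIdeal = Ideal.span {PowerSeries.C c}) :
    PrimeSpectrum.comap (invol p).toRingHom 𝔭 = 𝔭 :=
  PrimeSpectrum.ext (by rw [PrimeSpectrum.comap_asIdeal, h𝔭, comap_invol_span_C])

/-- And for the augmentation prime given by its ideal: if `𝔭.asIdeal = (T)` then `ι𝔭 = 𝔭`. [cite: Washington1997, §13.2] -/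
theorem comap_invol_eq_self_of_asIdeal_eq_span_X (𝔭 : PrimeSpectrum (IwasawaAlgebra p))
    (h𝔭 : 𝔭.asIdeal = Ideal.span {(PowerSeries.X : IwasawaAlgebra p)}) :
    PrimeSpectrum.comap (invol p).toRingHom 𝔭 = 𝔭 :=
  PrimeSpectrum.ext (by rw [PrimeSpectrum.comap_asIdeal, h𝔭, comap_invol_span_X])

end Literature.NumberTheory.EllipticCurves.IwasawaAlgebra

end
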